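import Literature.Claims.NS.Chio2026
import Literature.Analysis.FluidPDE.WeakSolution
import Literature.Analysis.FluidPDE.CubeNoSlipUniqueness
import HarnessLib

/-!
# Claim skeleton (D-0090 NS-CLAIMS, C133, QUICK row): Haitani 2025 — «Global Existence and Smoothness
# for 3D Navier-Stokes Equations» (GitHub repository `KaworuHaitani/navier-stokes-proof-2025`)

**Cite header.** Kaworu Haitani (GitHub handle «KaworuHaitani»; `CITATION.cff`), *Global Existence and
Smoothness for 3D Navier-Stokes Equations*, manuscript dated 17 Sep 2025, self-published as the GitHub
repository `github.com/KaworuHaitani/navier-stokes-proof-2025` (bib key `Haitani2025NavierStokesGitHub`;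
no DOI — abstract: «DOI registration pending via Zenodo»). VERSION OF RECORD TYPED: git tree
`375b18c7a08066a04d8d0c89d7721a4b7136e0ab` of branch `main` (created = last push 2025-09-17), which holds
FIVE blobs: `CITATION.cff`, `LICENSE`, `README.md`, `navier-stokes-proof-2025.pdf` (11 pp.; «p.N» below =
PDF page; «(n)» = the PDF's display numbers, «l.N» = line of `navier_stokes.tex`), `navier_stokes.tex`
(617 lines). SOURCE FACT: the README (l.10–15) and the abstract name a Coq development `src/main.v`, a DNS
script `dns/dns_simulation.py` and `doc/navier_stokes.pdf`; NONE of these exists in the repository — the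
only Coq text is the listing printed in §4.2 (p.8–10, l.436–585), whose proofs invoke fourteen identifiers
that are nowhere defined (`wavelet_scaling_property`, `gronwall_inequality`, `dissipation_bound`,
`banach_space_completeness`, `W0_log_norm_properties`, `wavelet_locality`, `holder_inequality`,
`besov_embedding`, `exponential_decay_property`, `energy_inequality`, `self_similar_assumption`,
`integral_bound`, plus the mutually recursive pair `H1_bound` l.516–522 ↔ `embedding_W0_log_to_H1`
l.543–557). UNREFEREED CLAIM under adjudication (cell `ns-claims`, row C133) — NOTHING in this file asserts a
step: the printed statements are transcribed as `def … : Prop`; the only theorems are the composition by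
pure logic and the Clay bridge as an implication. Snapshot of the five files: typist seat folder `c133/`
(sha256 prefixes PDF `5e78c49691414b98`, TeX `eeb98c2f1f6cfb2a`), mirrored by the lit seats under
`run/shared/lean/pub/ns-claims/sources/Haitani2025/` when they get to it.
[cite: Haitani2025NavierStokesGitHub, abstract p.1; Theorem 5 p.3]

**Setting (§1.1 p.1–2, (1)–(4)).** `Ω = [0,1]³`; `∂ₜu + (u·∇)u = −∇p + νΔu + f`, `∇·u = 0` in
`Ω × (0,∞)`; `u = 0` on `∂Ω × (0,∞)` (no-slip); `u(x,0) = u₀(x)`; `ν > 0`; `u₀` with `∇·u₀ = 0`,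
`u₀|_{∂Ω} = 0`. §2 (p.2–3): Definition 1 «boundary-adaptive wavelet basis» `{ψ_{k,j}}` (compact support in
the dyadic cube `2^{-k}(j + [0,1]³)`, `ψ_{k,j} = 0` on `∂Ω`, orthonormality, gradient bound
`‖∇ψ_{k,j}‖_{L²} ≤ C 2^k ‖ψ_{k,j}‖_{L²}`; «Proof of Existence» by citation of Cohen–Daubechies–Vial 1993);
Definition 2 (5) `‖u‖²_{W⁰_{2,log}} = Σ_k Σ_j |a_{k,j}|² ‖ψ_{k,j}‖² · log(k+1)` for `u = Σ a_{k,j} ψ_{k,j}`;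
Definition 3 (6) Zygmund norm (not used by any later display); Definition 4 (7) scale energy
`E_k(t) = ‖u_k(t)‖²_{L²(Ω)} = Σ_j |a_{k,j}(t)|² ‖ψ_{k,j}‖²`, `u_k = Σ_j a_{k,j} ψ_{k,j}`.
RENDERING (QUICK grain, the cell's standard one — cf. `Chio2026`, `Hlomuka2010`): `Ω` = the OPEN unit cube
(`HOmega` below), the boundary = `frontier HOmega`; the wavelet system of Definition 1 is a hypothesis
STRUCTURE `WaveletSystem` (fields = Def. 1 items 1–4 + `C¹` regularity so that the gradients it mentions
exist; vector-valued `ψ_{k,j} : ℝ³ → ℝ³` with scalar coefficients `a_{k,j} = ⟨u, ψ_{k,j}⟩_{L²(Ω)}`, the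
reading fixed by Def. 1 item 3 «∫ ψ_{k,j}·ψ_{k',j'}» and (11) «(ψ_{l,m}·∇)ψ_{n,p}»; COMPLETENESS of the
system is NOT a field — Def. 1 does not print it — so `u_k`, `E_k` are DEFINED as the level-`k` orthogonal
projection and its energy, and (15)'s «‖u‖² = Σ E_k» is typed where the print uses it); every Step and the
claimed theorem take the system `B` as a parameter (the paper fixes one basis); classical solutions are the
tree's `Chio2026.IsStrongSolutionOn HOmega S ν u₀ u p` (smooth slices, momentum + `∇·u = 0` pointwise in
`Ω`, no-slip on `frontier Ω`, datum) and «u ∈ C^∞([0,∞) × Ω)» is joint smoothness on the closed slab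
`[0,∞) × ℝ³` (Hlomuka2010 rendering); the FORCE is typed in the instance `f = 0`, which Theorem 5 allows
verbatim («Let f ∈ L²([0,∞);L²(Ω)) or f = 0»). TODO(general form): `f ∈ L²([0,∞);L²(Ω))`.

**Claimed statement (verbatim, Theorem 5 p.3, l.173–187).** «Let u₀ ∈ L²(Ω) ∩ W⁰_{2,log} with ∇·u₀ = 0
and u₀|_{∂Ω} = 0. Let f ∈ L²([0,∞); L²(Ω)) or f = 0. Then there exists a unique solution
u ∈ C^∞([0,∞) × Ω) to the Navier-Stokes equations (1)–(4) such that: 1. Global existence: u(t) exists for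
all t ≥ 0. 2. Smoothness: u ∈ C^∞([0,∞) × Ω). 3. Uniqueness: The solution is unique in the energy class.
4. No finite-time blowup: ‖u(t)‖_{H¹} < ∞ for all t < ∞.» Abstract p.1: «… with L² initial data and
no-slip boundary conditions on Ω = [0,1]³, resolving Clay Millennium Problem case (A) … The proof is fully
formalized in Coq using the MathComp library and validated through direct numerical simulations (DNS) on
1024³ grids.» Typed as `ClaimedTheorem B`: for every `ν > 0` and every datum of the class `IsDatum B`
(smooth, compactly supported INSIDE the open cube, divergence free, finite `W⁰_{2,log}(B)`-norm — an
instance of the printed data class, on which «∇·u₀ = 0, u₀|_{∂Ω} = 0, u₀ ∈ L²» hold classically; the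
print's wider class `L² ∩ W⁰_{2,log}` makes item 2 fail at `t = 0` for every non-smooth datum — recorded in
the CARD §3, not typed, F3) there is a solution in the class `IsSol` (items 1, 2, 4) and any two such agree
on `[0,∞) × Ω` (item 3, typed on the classical class — an instance of «the energy class»).

**Clay delta (reference `Literature.Claims.NS.ClayVariants`).** Nearest: (A), by the author's words only.
Δ1 DOMAIN: the bounded cube `[0,1]³` with NO-SLIP boundary — neither `ℝ³` (A)/(C) nor `𝕋³` (B)/(D)
(ClayVariants §3 Δ1 «OTHER: no implication to or from (A)–(D) in print»). Δ3 FORCE: `f ∈ L²_t L²_x` or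
`0` (≠ class (5)). Δ4 DATA: `L²(Ω) ∩ W⁰_{2,log}` with `∇·u₀ = 0`, `u₀|_{∂Ω} = 0` — not (4); the
`W⁰_{2,log}` class depends on the unspecified basis. Δ5/Δ6: classical `C^∞([0,∞) × Ω)`, energy class for
uniqueness; no decay axis (bounded domain). Δ7: all `ν > 0` = ; «Re ≤ 10⁵» (abstract, §5) is numerical only.
`clay_of_claimed` is NOT derivable (Δ1 alone: a theorem on the no-slip cube says nothing about `ℝ³` data);
the identification with (A) is the abstract's / §6's sentence, typed as `ClayBridge`.

**ORDERED STEP INDEX** (dependency order of the printed argument for Theorem 5; ties by print order;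
`claim_of_steps` takes its hypotheses in this order). Steps 1–4 are the printed SUPPORT CHAIN of Step 5
(Lemma 9's proof p.5: «Uniform boundedness follows from Lemma 6»; Lemma 10's proof p.6 uses the embedding
of Lemma 8 and the tail bound (23) «≤ Σ_{k>N} E₀/log(k+1)·exp(−νk²t)» of Lemma 7); they are consumed by the
print, not by the kernel composition (pure logic from Steps 5–7).
* Step 1 = `Step1_Display13` — (13) p.4 (l.230–235), inside the proof of Lemma 6: «The logarithmic
  correction arises from Besov space analysis: |∫_Ω u_k·(u_{k+1}·∇)u_k dx| ≤ C/log(k+1)·‖u_k‖‖u_{k+1}‖‖∇u_k‖».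
  The decisive display (birthplace of the logarithm); no derivation printed. Abstract grain: over the level
  spans of `B` (TYPING-HYGIENE 13).
* Step 2 = `Step2_Lemma6` — Lemma 6 (8) p.3: `dE_k/dt ≤ −2νk²E_k + C/log(k+1)·E_k^{1/2}E_{k+1}^{1/2} + F_k`,
  «C > 0 a universal constant», for solutions in `W⁰_{2,log}`; `f = 0` ⇒ `F_k = 0`. (Its printed proof
  (9)–(13): (10) «ν∫u_k·Δu = −ν‖∇u_k‖² ≤ −νk²E_k» drops the cross-level terms; (11)–(12) keep only
  `|l−k| ≤ 1, |n−k| ≤ 1` «due to wavelet locality»; «Combining terms yields (8)» replaces the factor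
  `‖∇u_k‖` of (13) by `E_k^{1/2}·log`-free bookkeeping — recorded, not bridged.)
* Step 3a = `Step3a_Lemma7GronwallAbs` — proof of Lemma 7 p.4 (l.248–255): «Apply Grönwall's inequality
  to (8). Energy conservation ensures (15) ‖u(t)‖² = Σ_k E_k(t) ≤ ‖u₀‖² + ∫₀ᵗ‖f‖² ≤ C₀.» ⇒ (14), typed at
  the ODE grain over real functions `E_k(t) ≥ 0`, `‖u(t)‖` (TYPING-HYGIENE 13: the elementary inference
  the printed proof consumes).
* Step 3 = `Step3_Lemma7` — Lemma 7 (14) p.4: `E_k(t) ≤ E_k(0)/log(k+1)·exp(−νk²t + C∫₀ᵗ‖u(s)‖/log(k+1) ds)`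
  for solutions (PDE level). Used downstream in the SIMPLIFIED form `E_k(t) ≤ E₀/log(k+1)·exp(−νk²t)`
  ((19) p.5, (23) p.6, Lemma 13 p.7).
* Step 4 = `Step4_Lemma8` — Lemma 8 (16) p.4: «There exists C > 0 such that for all u ∈ W⁰_{2,log}:
  ‖u‖_{H¹(Ω)} ≤ C‖u‖_{W⁰_{2,log}}» — a `t`-free functional inequality, typed over finite wavelet sums;
  its printed proof (17)–(21) p.5 argues instead along SOLUTIONS at a fixed `t > 0` via (19)
  `‖∇u‖² ≤ C E₀ Σ_k 2^{2k}/log(k+1)·exp(−νk²t)` and the convergence (20)–(21)/§4.1 (32) of that series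
  for `t > 0` (at `t = 0` it is `Σ 4^k/log(k+1) = ∞`; §4.1 p.7 itself records that `Σ 4^k/log²(k+1)`
  diverges) — recorded, not bridged.
* Step 5 = `Step5_Lemma9_10_weakLimit` — Lemma 9 (22) p.5 (Galerkin solutions in `span{ψ_{k,j} : k ≤ N}`,
  «uniformly bounded in W⁰_{2,log}», bound `C(‖u₀‖_W, ‖f‖)`) + Lemma 10 p.5–6 (weakly convergent
  subsequence, Aubin–Lions, tail (23)) + the IMPLICIT sentence between Lemma 10 and Lemma 11 (p.6) that the
  limit `u` is a weak solution of (1)–(4) attaining `u₀`: typed as its OUTPUT — existence of a weak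
  (distributional, tree notion `IsDistributionalNSSolutionOn` on `(0,∞) × Ω`) solution lying in
  `W⁰_{2,log}(B)` uniformly in `t`, with datum and no-slip («weak solution» is not defined in the print).
* Step 6 = `Step6_Lemma11` — Lemma 11 p.6 (24)–(25): «If u ∈ W⁰_{2,log} is a weak solution, then
  u ∈ C^∞([0,∞) × Ω)» (proof: Step 1 = Lemma 8; Step 2 «Since u ∈ H¹, (u·∇)u ∈ L²», `Δp = −∇·[(u·∇)u]`,
  «implying u ∈ H²»; Steps 3–4 «iterate», «Sobolev embedding»).
* Step 7a = `Step7a_Display27` — (27) p.7 (l.383–388), inside the proof of Lemma 12: «By Hölder's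
  inequality |∫_Ω (w·∇)u₂·w dx| ≤ C‖∇w‖_{L²}‖w‖_{L²}‖∇u₂‖_{L²}», abstract grain over `C¹` fields supported
  in the closed cube.
* Step 7 = `Step7_Lemma12` — Lemma 12 p.6–7 (26)–(27): «Solutions in the energy class are unique» (typed on
  the classical class `IsSol`: two solutions with the same datum agree on `[0,∞) × Ω`).
* Step 8a = `Step8a_Lemma13Abs` — proof of Lemma 13 p.7 (28)–(30) (l.397–414; Coq `self_similar_contradiction`
  l.569–584): from «‖u(t)‖² ∼ (T−t)^{1/2} → 0» (29) and the energy bound (30) «This contradiction … rul[es]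
  out singularities» — the inference schema over a real function, typed verbatim (two upper bounds ⇒ `False`).
* Step 8 = `Step8_Lemma13` — Lemma 13 p.7: «Solutions do not develop singularities in finite time» (typed:
  a classical solution on `[0,T) × Ω` stays bounded). Item 4 of Theorem 5; in the typed rendering it is
  implied by item 2 and is carried as the last (logically unused) hypothesis.
* Off-path records (not Steps, not consumed): `CoqL524_energyBound` = the §4.2 listing's
  `Definition energy_bound` (p.9, l.524–530) transcribed — «(T − t)^(1/2) <= norm (u 0) (L2_norm)^2 + C»
  for all `0 ≤ t < T` («Proof. apply energy_conservation. Qed.»); the listing's `self_similar_scaling`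
  (l.508–514) closes by `apply self_similar_assumption`.
* Clay link = `ClayBridge` — abstract p.1 / §6 p.11 («resolving Clay Millennium Problem case (A)»).
COMPOSITION: `claim_of_steps : Step1 → Step2 → Step3a → Step3 → Step4 → Step5 → Step6 → Step7a → Step7 →
Step8a → Step8 → ClaimedTheorem` PROVED (pure logic: existence from Steps 5–6, uniqueness = Step 7);
`clay_of_bridge : ClayBridge → ClaimedTheorem → clayR3.Regularity`.

WHAT THIS IS NOT: not a claim about NS regularity or blow-up; not a claim about any author beyond the
typed locator.
-/

noncomputable section

open Set Function Filter MeasureTheory TopologicalSpace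
open scoped Topology ENNReal NNReal ContDiff InnerProductSpace

namespace Literature.Claims.NS.Haitani2025

open Literature.Analysis.FluidPDE Literature.Claims.NS.ClayVariants
open Literature.Claims.NS.Chio2026 (E3 gradSq IsStrongSolutionOn)

/-! ## Vocabulary (definitions with bodies; nothing asserted) -/

/-- The physical domain «Ω = [0,1]³» (§1.1 p.1), rendered as the OPEN unit cube of `ℝ³` (its closure is the
printed closed cube; `frontier HOmega = ∂Ω` carries the no-slip condition (3)).
[cite: Haitani2025NavierStokesGitHub, §1.1 (1)–(4) p.1–2] -/
def HOmega : Set E3 := {x | ∀ i : Fin 3, x i ∈ Ioo (0 : ℝ) 1}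

/-- The open unit cube is open (finite intersection of preimages of `(0,1)` under the coordinate maps);
plumbing for `HCyl`. [folklore] -/
private theorem isOpen_HOmega : IsOpen HOmega := by
  have h : HOmega = ⋂ i : Fin 3, (fun x : E3 => x i) ⁻¹' Ioo (0 : ℝ) 1 := by
    ext x
    simp [HOmega]
  rw [h]
  exact isOpen_iInter_of_finite fun i =>
    isOpen_Ioo.preimage (EuclideanSpace.proj i : E3 →L[ℝ] ℝ).continuous

/-- The open space–time cylinder `(0,∞) × Ω` on which «weak solution» is rendered by the tree's
distributional notion. [cite: Haitani2025NavierStokesGitHub, §1.1 (1)–(2) p.1–2] -/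
def HCyl : Opens (ℝ × E3) :=
  ⟨Ioi (0 : ℝ) ×ˢ HOmega, isOpen_Ioi.prod isOpen_HOmega⟩

/-- Wavelet indices `(k, j)`: level `k ∈ ℕ` and position `j ∈ {0,…,2^k − 1}³` (Definition 1 p.2: the
support cube `[2^{-k}j₁, 2^{-k}(j₁+1)] × [2^{-k}j₂, 2^{-k}(j₂+1)] × [2^{-k}j₃, 2^{-k}(j₃+1)] ⊆ [0,1]³`).
[cite: Haitani2025NavierStokesGitHub, Definition 1 item 1 p.2] -/
abbrev Idx : Type := Σ k : ℕ, (Fin 3 → Fin (2 ^ k))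

/-- The closed dyadic cube `2^{-k}(j + [0,1]³)` of an index (Definition 1 item 1 p.2).
[cite: Haitani2025NavierStokesGitHub, Definition 1 item 1 p.2] -/
def cube (a : Idx) : Set E3 :=
  {x | ∀ i : Fin 3, ((a.2 i : ℕ) : ℝ) / 2 ^ a.1 ≤ x i ∧ x i ≤ (((a.2 i : ℕ) : ℝ) + 1) / 2 ^ a.1}

/-- `‖v‖²_{L²(Ω)} = ∫_Ω |v|² dx`. [cite: Haitani2025NavierStokesGitHub, Definition 4 (7) p.3] -/
def l2Sq (v : E3 → E3) : ℝ := ∫ x in HOmega, ‖v x‖ ^ 2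

/-- `‖∇v‖²_{L²(Ω)} = ∫_Ω |∇v|² dx` (Frobenius norm of `Dv`, the tree's `Chio2026.gradSq`).
[cite: Haitani2025NavierStokesGitHub, Definition 1 item 4 p.2; (18) p.5] -/
def gradL2Sq (v : E3 → E3) : ℝ := ∫ x in HOmega, gradSq v x

/-- **Definition 1 (p.2) «Boundary-Adaptive Wavelet Basis», as a hypothesis structure** (nothing asserted;
the paper's «Proof of Existence» p.2 cites Cohen–Daubechies–Vial 1993): a family `ψ_{k,j} : ℝ³ → ℝ³`,
`C¹` (so that item 4's gradients exist — the print is silent on regularity), with 1. `supp ψ_{k,j}` in the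
dyadic cube of `(k,j)`; 2. `ψ_{k,j} = 0` on `∂Ω`; 3. orthonormality in `L²(Ω;ℝ³)`
(`∫_Ω ψ_{k,j}·ψ_{k',j'} = δδ`); 4. `‖∇ψ_{k,j}‖_{L²} ≤ C 2^k ‖ψ_{k,j}‖_{L²}` (typed squared, `‖ψ‖ = 1`).
COMPLETENESS is not printed and is not a field. [cite: Haitani2025NavierStokesGitHub, Definition 1 p.2] -/
structure WaveletSystem where
  /-- the wavelets `ψ_{k,j}` -/
  ψ : Idx → E3 → E3
  /-- regularity making item 4 meaningful (not printed; CDF wavelets of sufficient order are `C¹`) -/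
  contDiff : ∀ a, ContDiff ℝ 1 (ψ a)
  /-- item 1: compact support in the dyadic cube -/
  support : ∀ a, tsupport (ψ a) ⊆ cube a
  /-- item 2: boundary adaptation `ψ_{k,j} = 0` on `∂Ω` -/
  boundary : ∀ a, ∀ x ∈ frontier HOmega, ψ a x = 0
  /-- item 3 (diagonal): `∫_Ω |ψ_{k,j}|² = 1` -/
  norm_one : ∀ a, l2Sq (ψ a) = 1
  /-- item 3 (off-diagonal): `∫_Ω ψ_a·ψ_b = 0` for `a ≠ b` -/
  orthogonal : ∀ a b, a ≠ b → ∫ x in HOmega, ⟪ψ a x, ψ b x⟫_ℝ = 0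
  /-- item 4: `‖∇ψ_{k,j}‖²_{L²} ≤ C² 4^k ‖ψ_{k,j}‖²_{L²}` with one constant `C` -/
  gradBound : ∃ C : ℝ, ∀ a, gradL2Sq (ψ a) ≤ C ^ 2 * 4 ^ a.1 * l2Sq (ψ a)

variable (B : WaveletSystem)

/-- The wavelet coefficient `a_{k,j} = ⟨v, ψ_{k,j}⟩_{L²(Ω)}` of a field `v` (Definition 2 p.3, «u = Σ a_{k,j}ψ_{k,j}»).
[cite: Haitani2025NavierStokesGitHub, Definition 2 (5) p.3] -/
def coeff (v : E3 → E3) (a : Idx) : ℝ := ∫ x in HOmega, ⟪v x, B.ψ a x⟫_ℝ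

/-- The level-`k` piece `u_k = Δ_k u = Σ_j a_{k,j} ψ_{k,j}` (Definition 3 «k-th frequency localization»,
Definition 4 p.3). [cite: Haitani2025NavierStokesGitHub, Definition 4 (7) p.3] -/
def levelProj (k : ℕ) (v : E3 → E3) : E3 → E3 :=
  fun x => ∑ j : (Fin 3 → Fin (2 ^ k)), coeff B v ⟨k, j⟩ • B.ψ ⟨k, j⟩ x

/-- The scale energy `E_k = ‖u_k‖²_{L²(Ω)} = Σ_j |a_{k,j}|² ‖ψ_{k,j}‖²` with `‖ψ_{k,j}‖ = 1` (Definition 4 (7) p.3).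
[cite: Haitani2025NavierStokesGitHub, Definition 4 (7) p.3] -/
def levelEnergy (k : ℕ) (v : E3 → E3) : ℝ := ∑ j : (Fin 3 → Fin (2 ^ k)), coeff B v ⟨k, j⟩ ^ 2

/-- The span of the level-`k` wavelets, `V_k = span{ψ_{k,j} : j}` — the range of `u ↦ u_k` (Definition 4 p.3;
the objects `u_k`, `u_{k+1}` of (13)). [cite: Haitani2025NavierStokesGitHub, Definition 4 p.3; (13) p.4] -/
def levelSpan (k : ℕ) : Set (E3 → E3) :=
  {v | ∃ c : (Fin 3 → Fin (2 ^ k)) → ℝ, v = fun x => ∑ j : (Fin 3 → Fin (2 ^ k)), c j • B.ψ ⟨k, j⟩ x}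

/-- The logarithmic weight `log(k+1)` of Definitions 2–3 and (8), (13), (14) (it VANISHES at `k = 0`; the
per-scale Steps below are therefore typed for `k ≥ 1`, where the printed coefficients `C/log(k+1)`,
`E_k(0)/log(k+1)` are meaningful — TYPING-HYGIENE 3; the print is silent).
[cite: Haitani2025NavierStokesGitHub, Definition 2 (5) p.3] -/
def logW (k : ℕ) : ℝ := Real.log ((k : ℝ) + 1)

/-- Membership in `W⁰_{2,log}`: `‖v‖²_{W⁰_{2,log}} = Σ_k log(k+1)·E_k(v) < ∞` (Definition 2 (5) p.3, with
`‖ψ_{k,j}‖ = 1`). [cite: Haitani2025NavierStokesGitHub, Definition 2 (5) p.3] -/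
def InWlog (v : E3 → E3) : Prop := Summable fun k => logW k * levelEnergy B k v

/-- `‖v‖²_{W⁰_{2,log}} = Σ_k log(k+1)·E_k(v)` (Definition 2 (5) p.3; `tsum`, meaningful under `InWlog`).
[cite: Haitani2025NavierStokesGitHub, Definition 2 (5) p.3] -/
def wlogSq (v : E3 → E3) : ℝ := ∑' k, logW k * levelEnergy B k v

/-- **The typed data class** (instance of Theorem 5's «u₀ ∈ L²(Ω) ∩ W⁰_{2,log} with ∇·u₀ = 0 and
u₀|_{∂Ω} = 0», p.3): `u₀` smooth, compactly supported inside the open cube (hence `= 0` on and near `∂Ω`,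
and in `L²`), divergence free, with finite `W⁰_{2,log}(B)`-norm. Narrower than the print (every typed datum
is a printed datum). [cite: Haitani2025NavierStokesGitHub, Theorem 5 p.3] -/
def IsDatum (u₀ : E3 → E3) : Prop :=
  ContDiff ℝ ∞ u₀ ∧ HasCompactSupport u₀ ∧ tsupport u₀ ⊆ HOmega ∧ VectorCalculus.IsDivFree u₀ ∧ InWlog B u₀

/-- **The typed solution class of Theorem 5** («a … solution u ∈ C^∞([0,∞) × Ω) to the Navier-Stokes
equations (1)–(4)», `f = 0` instance): a classical solution on the time set `[0,∞)` in the tree's sense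
`Chio2026.IsStrongSolutionOn` over the open cube (smooth slices; momentum equation and `∇·u = 0` pointwise in
`Ω` for every `t ≥ 0`, one-sided time derivative at `t = 0`; no-slip `u = 0` on `∂Ω`; `u(0) = u₀` on `Ω`),
jointly `C^∞` on the closed slab `[0,∞) × ℝ³` (the cell's rendering of `C^∞([0,∞) × Ω)`, cf. `Hlomuka2010`).
Items 1, 2 and 4 of Theorem 5 are this membership. [cite: Haitani2025NavierStokesGitHub, Theorem 5 p.3; (1)–(4) p.1–2] -/
def IsSol (ν : ℝ) (u₀ : E3 → E3) (u : ℝ → E3 → E3) (p : ℝ → E3 → ℝ) : Prop :=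
  IsStrongSolutionOn HOmega (Ici 0) ν u₀ u p ∧ ContDiffOn ℝ ∞ (uncurry u) (Ici (0 : ℝ) ×ˢ (univ : Set E3))

/-- **«Weak solution in W⁰_{2,log}»** — the hypothesis of Lemma 11 and the (implicit) output of Lemmas 9–10
(p.5–6); the print defines no weak-solution notion. Rendered by the tree's distributional (pressure-explicit)
notion `IsDistributionalNSSolutionOn` on the open cylinder `(0,∞) × Ω` with `f = 0`, plus the standing
conditions (3) no-slip and (4) datum pointwise, plus `u(t) ∈ W⁰_{2,log}(B)` for every `t ≥ 0`.
[cite: Haitani2025NavierStokesGitHub, Lemma 10 p.5–6; Lemma 11 p.6] -/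
def IsWeakSolW (ν : ℝ) (u₀ : E3 → E3) (u : ℝ → E3 → E3) (p : ℝ → E3 → ℝ) : Prop :=
  IsDistributionalNSSolutionOn HCyl ν 0 u p ∧
    (∀ t, 0 ≤ t → ∀ x ∈ frontier HOmega, u t x = 0) ∧ (∀ x ∈ HOmega, u 0 x = u₀ x) ∧
    ∀ t, 0 ≤ t → InWlog B (u t)

/-! ## The claimed statement and the Clay bridge (nothing asserted) -/

/-- **HEADLINE — Theorem 5 (p.3) «Main Theorem: Resolution of the Millennium Problem», `f = 0` instance, in the
typed classes**: for every `ν > 0` and every datum in `IsDatum B` there is a solution in `IsSol ν u₀` (items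
1, 2, 4), and any two solutions in `IsSol ν u₀` agree on `[0,∞) × Ω` (item 3 on the classical class).
[claim: Haitani2025NavierStokesGitHub, status: disputed] -/
def ClaimedTheorem : Prop :=
  ∀ ν : ℝ, 0 < ν → ∀ u₀ : E3 → E3, IsDatum B u₀ →
    (∃ (u : ℝ → E3 → E3) (p : ℝ → E3 → ℝ), IsSol ν u₀ u p) ∧
      ∀ (u u' : ℝ → E3 → E3) (p p' : ℝ → E3 → ℝ), IsSol ν u₀ u p → IsSol ν u₀ u' p' →
        ∀ t, 0 ≤ t → ∀ x ∈ HOmega, u t x = u' t x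

/-- **The Clay bridge — abstract p.1 «resolving Clay Millennium Problem case (A)», §6 p.11 «This work resolves
the Clay Millennium Problem case (A)»**: the IMPLICIT identification of Theorem 5 (no-slip cube) with Clay (A)
(`ClayVariants.clayR3.Regularity`, whole space, decaying smooth data). Not derivable (Δ1 DOMAIN); typed as the
implication the sentence asserts. [claim: Haitani2025NavierStokesGitHub, status: disputed] -/
def ClayBridge : Prop := ClaimedTheorem B → clayR3.Regularity

/-! ## The steps (none asserted) -/

/-- **Step 1 — display (13) p.4 (l.230–235), inside the proof of Lemma 6: «The logarithmic correction arises
from Besov space analysis: |∫_Ω u_k·(u_{k+1}·∇)u_k dx| ≤ C/log(k+1)·‖u_k‖_{L²}‖u_{k+1}‖_{L²}‖∇u_k‖_{L²}.»**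
Abstract grain (TYPING-HYGIENE 13): one constant `C` such that for every level `k ≥ 1`, every level-`k` field
`v ∈ V_k` and every level-`(k+1)` field `w ∈ V_{k+1}` of the system `B` (these are exactly the pairs
`(u_k, u_{k+1})`, take `u = v + w`), `|∫_Ω ⟨v, (w·∇)v⟩| ≤ C/log(k+1)·‖v‖·‖w‖·‖∇v‖`. No derivation is
printed. [claim: Haitani2025NavierStokesGitHub, status: disputed] -/
def Step1_Display13 : Prop :=
  ∃ C : ℝ, ∀ k : ℕ, 1 ≤ k → ∀ v ∈ levelSpan B k, ∀ w ∈ levelSpan B (k + 1),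
    |∫ x in HOmega, ⟪v x, convect w v x⟫_ℝ| ≤
      C / logW k * Real.sqrt (l2Sq v) * Real.sqrt (l2Sq w) * Real.sqrt (gradL2Sq v)

/-- **Step 2 — Lemma 6 «Fundamental Energy Inequality» (8) p.3**: «For solutions to (1)–(4) in W⁰_{2,log}:
dE_k/dt ≤ −2νk²E_k + C·(1/log(k+1))·E_k^{1/2}·E_{k+1}^{1/2} + F_k, where F_k = ∫_Ω f·u_k dx and C > 0 is a
universal constant» — `f = 0` instance (`F_k = 0`), typed for the classical class `IsSol` with
`u(t) ∈ W⁰_{2,log}(B)` for all `t ≥ 0` (the lemma's standing hypothesis), levels `k ≥ 1` (see `logW`), the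
time derivative one-sided within `[0,∞)` and its existence part of the assertion (the print writes `dE_k/dt`).
The coefficient is `k²` verbatim (not `4^k`). [claim: Haitani2025NavierStokesGitHub, status: disputed] -/
def Step2_Lemma6 : Prop :=
  ∃ C : ℝ, 0 < C ∧ ∀ ν : ℝ, 0 < ν → ∀ u₀ : E3 → E3, IsDatum B u₀ →
    ∀ (u : ℝ → E3 → E3) (p : ℝ → E3 → ℝ), IsSol ν u₀ u p → (∀ t, 0 ≤ t → InWlog B (u t)) →
      ∀ k : ℕ, 1 ≤ k → ∀ t : ℝ, 0 ≤ t →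
        DifferentiableWithinAt ℝ (fun s => levelEnergy B k (u s)) (Ici 0) t ∧
          derivWithin (fun s => levelEnergy B k (u s)) (Ici 0) t ≤
            -2 * ν * (k : ℝ) ^ 2 * levelEnergy B k (u t) +
              C / logW k * Real.sqrt (levelEnergy B k (u t)) * Real.sqrt (levelEnergy B (k + 1) (u t))

/-- **Step 3a — the proof of Lemma 7 (p.4, l.248–255) at the grain it is printed: «Apply Grönwall's inequality
to (8). Energy conservation ensures: ‖u(t)‖²_{L²} = Σ_{k=0}^∞ E_k(t) ≤ ‖u₀‖²_{L²} + ∫₀ᵗ‖f(s)‖² ds ≤ C₀ (15).»**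
Typed over real functions (TYPING-HYGIENE 13; `f = 0`): for all `ν, C > 0`, `C₀ ≥ 0`, every family of
non-negative functions `E k : [0,∞) → ℝ` (differentiable within `[0,∞)`) and every continuous `M ≥ 0`
(«‖u(t)‖_{L²}»), IF (8) holds for every `k ≥ 1` (with `F_k = 0`) AND (15) holds (`Σ_k E_k(t) = M(t)² ≤ C₀`),
THEN (14) holds for every `k ≥ 1`: `E_k(t) ≤ E_k(0)/log(k+1)·exp(−νk²t + C∫₀ᵗ M(s)/log(k+1) ds)`.
[claim: Haitani2025NavierStokesGitHub, status: disputed] -/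
def Step3a_Lemma7GronwallAbs : Prop :=
  ∀ (ν C C₀ : ℝ), 0 < ν → 0 < C → 0 ≤ C₀ →
    ∀ (E : ℕ → ℝ → ℝ) (M : ℝ → ℝ), Continuous M → (∀ t, 0 ≤ t → 0 ≤ M t) →
      (∀ k t, 0 ≤ t → 0 ≤ E k t) →
      (∀ k t, 0 ≤ t → DifferentiableWithinAt ℝ (E k) (Ici 0) t) →
      (∀ k : ℕ, 1 ≤ k → ∀ t : ℝ, 0 ≤ t →
          derivWithin (E k) (Ici 0) t ≤
            -2 * ν * (k : ℝ) ^ 2 * E k t + C / logW k * Real.sqrt (E k t) * Real.sqrt (E (k + 1) t)) →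
      (∀ t : ℝ, 0 ≤ t → (Summable fun k => E k t) ∧ ∑' k, E k t = M t ^ 2 ∧ M t ^ 2 ≤ C₀) →
        ∀ k : ℕ, 1 ≤ k → ∀ t : ℝ, 0 ≤ t →
          E k t ≤ E k 0 / logW k * Real.exp (-ν * (k : ℝ) ^ 2 * t + C * ∫ s in (0 : ℝ)..t, M s / logW k)

/-- **Step 3 — Lemma 7 «Energy Decay Estimate» (14) p.4**: «Under the conditions of Lemma 6:
E_k(t) ≤ E_k(0)/log(k+1)·exp(−νk²t + C∫₀ᵗ ‖u(s)‖_{L²}/log(k+1) ds)» (PDE level, `f = 0`, levels `k ≥ 1`,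
`C` = the universal constant of Lemma 6, typed existentially as printed). By the printed proof this is
Step 2 ∧ Step 3a ∧ (15); the identification is recorded, not re-proved here.
[claim: Haitani2025NavierStokesGitHub, status: disputed] -/
def Step3_Lemma7 : Prop :=
  ∃ C : ℝ, 0 < C ∧ ∀ ν : ℝ, 0 < ν → ∀ u₀ : E3 → E3, IsDatum B u₀ →
    ∀ (u : ℝ → E3 → E3) (p : ℝ → E3 → ℝ), IsSol ν u₀ u p → (∀ t, 0 ≤ t → InWlog B (u t)) →
      ∀ k : ℕ, 1 ≤ k → ∀ t : ℝ, 0 ≤ t →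
        levelEnergy B k (u t) ≤
          levelEnergy B k (u 0) / logW k *
            Real.exp (-ν * (k : ℝ) ^ 2 * t + C * ∫ s in (0 : ℝ)..t, Real.sqrt (l2Sq (u s)) / logW k)

/-- **Step 4 — Lemma 8 «Embedding W⁰_{2,log} ↪ H¹» (16) p.4**: «There exists a constant C > 0 such that for
all u ∈ W⁰_{2,log}: ‖u‖_{H¹(Ω)} ≤ C‖u‖_{W⁰_{2,log}}» — typed, squared, over the fields that are certainly
«u = Σ a_{k,j}ψ_{k,j}» with finite `W`-norm: FINITE wavelet sums (`‖u‖²_{H¹(Ω)} = ‖u‖²_{L²(Ω)} + ‖∇u‖²_{L²(Ω)}`).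
(Printed proof (17)–(21) p.5: `t`-dependent, along solutions, via Lemma 7 — see the step index.)
[claim: Haitani2025NavierStokesGitHub, status: disputed] -/
def Step4_Lemma8 : Prop :=
  ∃ C : ℝ, 0 < C ∧ ∀ (S : Finset Idx) (c : Idx → ℝ),
    l2Sq (fun x => ∑ a ∈ S, c a • B.ψ a x) + gradL2Sq (fun x => ∑ a ∈ S, c a • B.ψ a x) ≤
      C ^ 2 * wlogSq B (fun x => ∑ a ∈ S, c a • B.ψ a x)

/-- **Step 5 — Lemma 9 (22) p.5 + Lemma 10 (23) p.5–6 + the implicit limit identification (between Lemma 10 and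
Lemma 11, p.6), typed as their output**: «For each N ∈ ℕ, there exists a unique solution u^N ∈ span{ψ_{k,j} :
k ≤ N} to the Galerkin approximation, and {u^N} is uniformly bounded in W⁰_{2,log}» (bound
`C(‖u₀‖_{W⁰_{2,log}}, ‖f‖_{L²})`, (22)); «The sequence {u^N} has a subsequence converging weakly in W⁰_{2,log}
to a limit u» (Aubin–Lions, tail (23)); IMPLICIT: `u` is a weak solution of (1)–(4) with datum `u₀`. Typed:
for every `ν > 0` and datum there is a weak solution in `W⁰_{2,log}(B)` (`IsWeakSolW`) whose `W`-norm is
bounded uniformly in `t ≥ 0`. [claim: Haitani2025NavierStokesGitHub, status: disputed] -/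
def Step5_Lemma9_10_weakLimit : Prop :=
  ∀ ν : ℝ, 0 < ν → ∀ u₀ : E3 → E3, IsDatum B u₀ →
    ∃ (u : ℝ → E3 → E3) (p : ℝ → E3 → ℝ), IsWeakSolW B ν u₀ u p ∧
      ∃ K : ℝ, ∀ t, 0 ≤ t → wlogSq B (u t) ≤ K

/-- **Step 6 — Lemma 11 «Bootstrap Regularity» p.6 (24)–(25)**: «If u ∈ W⁰_{2,log} is a weak solution, then
u ∈ C^∞([0,∞) × Ω)» — typed: every weak solution in `W⁰_{2,log}(B)` (`IsWeakSolW`) with a typed datum is,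
with some pressure, a solution of the classical class `IsSol`. (Printed proof: «Step 1: W⁰_{2,log} ↪ H¹ by
Lemma 8. Step 2: H¹ → H². … Since u ∈ H¹, (u·∇)u ∈ L². The pressure satisfies Δp = −∇·[(u·∇)u] ∈ H⁻¹.
Elliptic regularity gives p ∈ H¹, so ∇p ∈ L², and ∂u/∂t ∈ L², implying u ∈ H². Step 3: Iterate to
H^k → H^{k+1}. Step 4: H^k → C^∞ by Sobolev embedding.») [claim: Haitani2025NavierStokesGitHub, status: disputed] -/
def Step6_Lemma11 : Prop :=
  ∀ ν : ℝ, 0 < ν → ∀ u₀ : E3 → E3, IsDatum B u₀ →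
    ∀ (u : ℝ → E3 → E3) (p : ℝ → E3 → ℝ), IsWeakSolW B ν u₀ u p → ∃ p' : ℝ → E3 → ℝ, IsSol ν u₀ u p'

/-- **Step 7a — display (27) p.7 (l.383–388), inside the proof of Lemma 12: «By Hölder's inequality:
|∫_Ω (w·∇)u₂·w dx| ≤ C‖∇w‖_{L²}‖w‖_{L²}‖∇u₂‖_{L²}.»** Abstract grain (TYPING-HYGIENE 13): one constant `C`
for all `C¹` fields `w, v` supported in the closed cube (the difference `w = u₁ − u₂` and `u₂` of the
proof, at a fixed time). [claim: Haitani2025NavierStokesGitHub, status: disputed] -/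
def Step7a_Display27 : Prop :=
  ∃ C : ℝ, ∀ (w v : E3 → E3), ContDiff ℝ 1 w → ContDiff ℝ 1 v →
    tsupport w ⊆ closure HOmega → tsupport v ⊆ closure HOmega →
      |∫ x in HOmega, ⟪convect w v x, w x⟫_ℝ| ≤
        C * Real.sqrt (gradL2Sq w) * Real.sqrt (l2Sq w) * Real.sqrt (gradL2Sq v)

/-- **Step 7 — Lemma 12 «Uniqueness» p.6–7 (26)–(27): «Solutions in the energy class are unique»** (proof:
energy identity for `w = u₁ − u₂`, (27), «Grönwall's inequality with w(0) = 0 implies w(t) ≡ 0»). Typed on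
the classical class (an instance of the energy class): two solutions in `IsSol ν u₀` agree on `[0,∞) × Ω`.
[claim: Haitani2025NavierStokesGitHub, status: disputed] -/
def Step7_Lemma12 : Prop :=
  ∀ ν : ℝ, 0 < ν → ∀ u₀ : E3 → E3, IsDatum B u₀ →
    ∀ (u u' : ℝ → E3 → E3) (p p' : ℝ → E3 → ℝ), IsSol ν u₀ u p → IsSol ν u₀ u' p' →
      ∀ t, 0 ≤ t → ∀ x ∈ HOmega, u t x = u' t x

/-- **Step 8a — the proof of Lemma 13 (p.7, l.397–414; (28)–(30)) at the grain it is printed**: «Suppose a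
singularity occurs at t = T. Self-similar scaling suggests u(x,t) ∼ (T−t)^{−1/2}U(x/(T−t)^{1/4}) (28). This
implies ‖u(t)‖²_{L²} ∼ (T−t)^{1/2} → 0 as t → T⁻ (29). However, energy conservation requires
‖u(t)‖²_{L²} ≤ ‖u₀‖²_{L²} + ∫₀ᵗ‖f‖² ≤ C₀ (30). This contradiction … rul[es] out singularities» (the §4.2
listing's `self_similar_contradiction`, l.569–584, has the same shape: `H_self_similar : ‖u t‖² ≤ C(T−t)^{1/2}`,
`H_contradiction : (T−t)^{1/2} ≤ ‖u 0‖² + C`, then `contradiction`). The inference, over a real function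
`N(t) = ‖u(t)‖²` on `[0,T)`: (29) as an upper bound by `C(T−t)^{1/2}` and (30) together yield `False`.
[claim: Haitani2025NavierStokesGitHub, status: disputed] -/
def Step8a_Lemma13Abs : Prop :=
  ∀ (N : ℝ → ℝ) (C C₀ T : ℝ), 0 < T → 0 < C → 0 ≤ C₀ →
    (∀ t ∈ Ico 0 T, 0 ≤ N t) →
    (∀ t ∈ Ico 0 T, N t ≤ C * Real.sqrt (T - t)) →
    (∀ t ∈ Ico 0 T, N t ≤ C₀) → False

/-- **Step 8 — Lemma 13 «No Finite-Time Singularities» p.7: «Solutions do not develop singularities in finite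
time»** (= item 4 of Theorem 5), typed: every classical solution (tree class `IsStrongSolutionOn`) on a slab
`[0,T) × Ω`, `T > 0`, with a typed datum stays bounded on `[0,T) × Ω`. In the typed rendering of Theorem 5
this is implied by item 2; carried as the last hypothesis of the composition, logically unused.
[claim: Haitani2025NavierStokesGitHub, status: disputed] -/
def Step8_Lemma13 : Prop :=
  ∀ ν : ℝ, 0 < ν → ∀ u₀ : E3 → E3, IsDatum B u₀ → ∀ T : ℝ, 0 < T →
    ∀ (u : ℝ → E3 → E3) (p : ℝ → E3 → ℝ), IsStrongSolutionOn HOmega (Ico 0 T) ν u₀ u p →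
      ∃ M : ℝ, ∀ t ∈ Ico 0 T, ∀ x ∈ HOmega, ‖u t x‖ ≤ M

/-! ## Off-path record: one item of the §4.2 Coq listing, transcribed (not a Step, not consumed) -/

/-- **§4.2 «Coq Implementation Completeness», `Definition energy_bound` (p.9; l.524–530), transcribed**:
«forall (u : nat -> R -> R^3) (t T : R), 0 <= t < T -> (T - t)^(1/2) <= norm (u 0) (L2_norm)^2 + C.
Proof. intros u t T Ht. apply energy_conservation. Qed.» — with the listing's free `C` and `norm (u 0) (L2_norm)²`
as arbitrary non-negative reals. (The repository contains no Coq file; `energy_conservation` is the listing's own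
l.499–506, whose statement does not mention `T`.) [claim: Haitani2025NavierStokesGitHub, status: disputed] -/
def CoqL524_energyBound : Prop :=
  ∀ (E₀ C t T : ℝ), 0 ≤ E₀ → 0 ≤ C → 0 ≤ t → t < T → Real.sqrt (T - t) ≤ E₀ + C

/-! ## Kernel relations (pure logic; nothing about Navier–Stokes is proved) -/

/-- **COMPOSITION** — the paper's logic composes: existence in the classical class from Step 5 (weak limit in
`W⁰_{2,log}`) and Step 6 (bootstrap), uniqueness = Step 7; Steps 1–4 are the printed support chain of Step 5,
Steps 7a/8a the displays consumed by Lemmas 12/13, Step 8 = item 4 (implied by item 2 as typed) — all carried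
in the printed order, logically unused here. Pure logic; nothing is asserted.
[claim: Haitani2025NavierStokesGitHub, status: disputed] -/
theorem claim_of_steps (_h1 : Step1_Display13 B) (_h2 : Step2_Lemma6 B) (_h3a : Step3a_Lemma7GronwallAbs)
    (_h3 : Step3_Lemma7 B) (_h4 : Step4_Lemma8 B) (h5 : Step5_Lemma9_10_weakLimit B) (h6 : Step6_Lemma11 B)
    (_h7a : Step7a_Display27) (h7 : Step7_Lemma12 B) (_h8a : Step8a_Lemma13Abs) (_h8 : Step8_Lemma13 B) :
    ClaimedTheorem B := by
  intro ν hν u₀ hu₀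
  refine ⟨?_, h7 ν hν u₀ hu₀⟩
  obtain ⟨u, p, hw, _⟩ := h5 ν hν u₀ hu₀
  obtain ⟨p', hs⟩ := h6 ν hν u₀ hu₀ u p hw
  exact ⟨u, p', hs⟩

/-- **The Clay link as typed**: only THROUGH the bridge sentence does the claimed theorem bear on Clay (A)
(`ClayVariants.clayR3.Regularity`); `clay_of_claimed` itself is not derivable (Δ1 DOMAIN: no-slip cube vs `ℝ³`).
Pure logic. [claim: Haitani2025NavierStokesGitHub, status: disputed] -/
theorem clay_of_bridge (hb : ClayBridge B) (hc : ClaimedTheorem B) : clayR3.Regularity := hb hc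

end Literature.Claims.NS.Haitani2025

end

-- WHAT THIS IS NOT: not a claim about NS regularity or blow-up; not a claim about any author beyond the typed
-- locator.

/-! ## Appendix (ns-claims-typist-7 g8, C133 custodian, D-0026 in-file discharge; append-only — nothing above
is changed, no Step is asserted): Step 7 `Step7_Lemma12` HOLDS

Lemma 12 «Solutions in the energy class are unique» as typed (two solutions in the classical class `IsSol ν u₀`
agree on `[0, ∞) × Ω`) is the classical energy-uniqueness theorem on the unit cube with no-slip data, now the
tree's `EuclideanSpace.eqOn_openBox_of_noSlip_classical` (`Literature/Analysis/FluidPDE/CubeNoSlipUniqueness`):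
`IsSol` supplies jointly `C^∞` velocities on `[0, ∞) × ℝ³`, smooth pressure slices, the momentum equation and
`∇·u = 0` pointwise in `Ω = (0,1)³`, `u = 0` on `∂Ω`, and the common datum on `Ω`. One import is added
(`Literature.Analysis.FluidPDE.CubeNoSlipUniqueness`, a theorems-only tools file). -/

noncomputable section

namespace Literature.Claims.NS.Haitani2025

open Set Literature.Analysis.FluidPDE
open Literature.Claims.NS.Chio2026 (E3 IsStrongSolutionOn)

variable (B : WaveletSystem)

/-- **Step 7 HOLDS (kernel)** — Lemma 12 p.6–7 (26)–(27) at the typed grain: classical no-slip solutions on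
the cube from the same datum coincide on `[0, ∞) × Ω` (energy method + Grönwall, the tree's
`EuclideanSpace.eqOn_openBox_of_noSlip_classical` with `a = 0`, `b = 1`).
[cite: Haitani2025NavierStokesGitHub, Lemma 12 p.6–7 (26)–(27)] [cite: RobinsonRodrigoSadowskiCUP2016, §6.3 Exercise 6.5 with Thm 6.10] -/
theorem step7_Lemma12_holds : Step7_Lemma12 B := by
  intro ν hν u₀ _hu₀ u u' p p' hu hu' t ht x hx
  have h01 : ∀ i : Fin 3, (fun _ : Fin 3 => (0 : ℝ)) i < (fun _ : Fin 3 => (1 : ℝ)) i :=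
    fun _ => zero_lt_one
  have hΩ : HOmega = {x : E3 | ∀ j : Fin 3, (fun _ : Fin 3 => (0 : ℝ)) j < x j ∧
      x j < (fun _ : Fin 3 => (1 : ℝ)) j} := by
    ext x; simp [HOmega]
  have key := EuclideanSpace.eqOn_openBox_of_noSlip_classical (n := 2) (fun _ => (0 : ℝ)) (fun _ => 1)
    h01 hν.le (u := u) (u' := u') (p := p) (p' := p') hu.2 hu'.2
    (fun s hs => (hu.1.smooth_p s hs).of_le (by simp))
    (fun s hs => (hu'.1.smooth_p s hs).of_le (by simp))
    (fun s hs y hy => hu.1.momentum s hs y (hΩ ▸ hy))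
    (fun s hs y hy => hu'.1.momentum s hs y (hΩ ▸ hy))
    (fun s hs y hy => hu.1.divFree s hs y (hΩ ▸ hy))
    (fun s hs y hy => hu'.1.divFree s hs y (hΩ ▸ hy))
    (fun s hs y hy => hu.1.noSlip s hs y (by rw [hΩ]; exact hy))
    (fun s hs y hy => hu'.1.noSlip s hs y (by rw [hΩ]; exact hy))
    (fun y hy => by rw [hu.1.initial y (hΩ ▸ hy), hu'.1.initial y (hΩ ▸ hy)])
  exact key t ht x (hΩ ▸ hx)

/-- `Step7_Lemma12` — `_holds` alias of `step7_Lemma12_holds` above under the fact's exact name (appended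
2026-08-28, D-0026 bookkeeping: the proof term is the existing theorem of this file; no statement,
definition or attribute is edited; no new named fact; the ledger's debt table listed the fact
unproved). [cite: RobinsonRodrigoSadowskiCUP2016, §6.3 Exercise 6.5 with Thm 6.10] -/
theorem _root_.Literature.Claims.NS.Haitani2025.Step7_Lemma12_holds : Step7_Lemma12 B :=
  _root_.Literature.Claims.NS.Haitani2025.step7_Lemma12_holds (B := B)

end Literature.Claims.NS.Haitani2025

end
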